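import Summits.HodgeConjecture.CorCM.IrreducibleOddWeightsRightIdealsHecke
import HarnessLib

/-!
# Right ideals, V: FAMILIES over a common pivot — the exact defect
# `Σ_i dim Hg(A_i) − dim Hg(∏_i A_i) = Σ_i dim(w_iℚ[Γ]) − dim(Σ_i w_iℚ[Γ])` for the shadows on a Galois pivot

COR-CM (cell `pub-hodgecm2`, binder seat `b16` gen 64, count-neutral claim RIGHT IDEALS, file R5 — abstract `G`-set
level; theorems only, no definition, no named fact, no `sorry`).  NEW as stated, hence under `Summits/`.  HONEST FRAMING:
finite-dimensional linear algebra about the Kubota–Dodson rank of a family of CM types (`dim Hg(∏_i A_i)` versus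
`Σ_i dim Hg(A_i)`); `HC_CM` is neither used nor asserted.

SETTING (R1 `IrreducibleOddWeightsRightIdeals`, R3/R3b `…RightIdeals{Pivot,Hecke}`).  Slots `E_i`, types `Φ_i`,
matrix-coefficient spaces `MC_i ≤ ℚ^G`; by R1 the family defect is `Σ_i dim Hg(A_i) − dim Hg(∏_i A_i) =
Σ_i dim MC_i − dim Σ_i MC_i` — the dimension of the space of RELATIONS `Σ_i c_i = 0`, `c_i ∈ MC_i`.  Pivot maps
`r_i : E_i → Y` with fibre-sum spaces `F_i ≤ MC_i` (Hecke modules `w_iℚ[Γ]` of the shadows on a torsor, R3b).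

* §1 `sum_finrank_add_finrank_iSup_eq_of_forall_rel` — bookkeeping: for subspaces `B_i ≤ C_i` such that every relation
  `Σ_i w_i = 0` with `w_i ∈ C_i` has all `w_i ∈ B_i`, the two families have the SAME defect:
  `Σ_i dim C_i + dim ⨆_i B_i = Σ_i dim B_i + dim ⨆_i C_i` (component-wise inclusion `Π_i B_i → Π_i C_i` identifies the
  kernels of the two summation maps).
* §2 **`mem_span_fibreSum_of_rel`** — in a relation `Σ_i c_i = 0` among matrix coefficients, EVERY component `c_j` is
  right-invariant under the pointwise stabiliser `N_j` of its own slot AND under `⋂_{i ≠ j} N_i` (it is minus the sum of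
  the others); so if `N ≤ ⟨N_j ∪ ⋂_{i≠j} N_i⟩` is transitive on the fibres of `r_j`, the averaging lemma of R3 puts `c_j`
  in `F_j`.  Hence **`sum_finrank_coeff_add_finrank_iSup_fibreSum_eq`**: under these hypotheses for every slot `j`
  (for `Aut(ℂ)`: each Galois closure `L_j` meets the compositum of the other closures inside `z₀(M)`), the defects of
  `(MC_i)` and `(F_i)` agree, and **`sum_typeRank_add_one_add_finrank_iSup_fibreSum_eq`**:
  `Σ_i rank Φ_i + 1 + dim ⨆_i F_i = rank(Σ) + |I| + Σ_i dim F_i`, i.e.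
  **`Σ_i dim Hg(A_i) − dim Hg(∏_i A_i) = Σ_i dim F_i − dim Σ_i F_i`**.
* §3 **`sum_typeRank_add_one_add_finrank_iSup_span_precomp_eq`** — THE HECKE READING on a torsor (`G` transitive on `Y`,
  `q_σ` commuting with `G`, `{q_σ y₀} = Y`; `r_i` equivariant): **`Σ_i dim Hg(A_i) − dim Hg(∏_i A_i) =
  Σ_i dim(w_iℚ[Γ]) − dim(Σ_i w_iℚ[Γ])`** — the defect of the family is the defect of the RIGHT IDEALS generated by the
  shadows `w_i = (r_i)_* u_i` in the group ring of the torsor (R4's pair formula is `|I| = 2`: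
  `dim(w₀ℚ[Γ]) + dim(w₁ℚ[Γ]) − dim(w₀ℚ[Γ] + w₁ℚ[Γ]) = dim(w₀ℚ[Γ] ∩ w₁ℚ[Γ])`).  In particular the family is additive iff
  the right ideals `w_iℚ[Γ]` are INDEPENDENT (`typeRank_sigmaType_add_card_eq_iff_iSupIndep_span_precomp`).

## References

* [Deligne1982HodgeCycles] P. Deligne, *Hodge cycles on abelian varieties*, LNM 900 (1982), I.5 (p. 53), I Ex. 3.7.
* [Gordon1999HodgeAVSurvey] B. B. Gordon, *A survey of the Hodge conjecture for abelian varieties*, §3 Theorem (Imai,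
  Murty) with proof, 7.5–7.7, 9.4.3.
* [Kubota1965] T. Kubota, *On the field extension by complex multiplication*, Trans. AMS 118 (1965), §2, §4.
* [Serre1977] J.-P. Serre, *Linear Representations of Finite Groups*, GTM 42, §3.3.
-/

set_option autoImplicit false

noncomputable section

open scoped BigOperators

universe u v v' w

namespace Summit.HodgeConjecture.CorCM.IrrOdd

open Literature.NumberTheory.ComplexMultiplication

/-! ### §1 Bookkeeping: families of subspaces with the same relations have the same defect -/

section Bookkeeping

variable {M : Type*} [AddCommGroup M] [Module ℚ M] {ι : Type*} [Fintype ι] [DecidableEq ι]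

/-- The summation map `Π_i C_i → M`, `w ↦ Σ_i w_i`, has range `⨆_i C_i`. [folklore] -/
theorem range_sum_subtype_comp_proj (C : ι → Submodule ℚ M) :
    LinearMap.range (∑ i, (C i).subtype ∘ₗ LinearMap.proj (R := ℚ) (φ := fun i => ↥(C i)) i) = ⨆ i, C i := by
  apply le_antisymm
  · rintro _ ⟨w, rfl⟩
    rw [LinearMap.sum_apply]
    exact Submodule.sum_mem _ fun i _ => Submodule.mem_iSup_of_mem i (w i).2
  · refine iSup_le fun i => fun m hm => ⟨Pi.single i ⟨m, hm⟩, ?_⟩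
    rw [LinearMap.sum_apply, Finset.sum_eq_single i (fun j _ hji => by
      rw [LinearMap.comp_apply, LinearMap.proj_apply, Pi.single_eq_of_ne hji, map_zero])
      (fun hi => (hi (Finset.mem_univ i)).elim)]
    rw [LinearMap.comp_apply, LinearMap.proj_apply, Pi.single_eq_same, Submodule.subtype_apply]

/-- `Σ_i dim C_i = dim ⨆_i C_i + dim ker(Σ)` for the summation map on `Π_i C_i`. [folklore] -/
theorem sum_finrank_eq_finrank_iSup_add_finrank_ker (C : ι → Submodule ℚ M) [∀ i, Module.Finite ℚ (C i)] :
    ∑ i, Module.finrank ℚ (C i) = Module.finrank ℚ (⨆ i, C i : Submodule ℚ M) +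
      Module.finrank ℚ (LinearMap.ker (∑ i, (C i).subtype ∘ₗ LinearMap.proj (R := ℚ) (φ := fun i => ↥(C i)) i)) := by
  rw [← range_sum_subtype_comp_proj C, LinearMap.finrank_range_add_finrank_ker, Module.finrank_pi_fintype]

/-- **Families of subspaces with the same relations have the same defect.**  If `B_i ≤ C_i` and every relation
`Σ_i w_i = 0` with `w_i ∈ C_i` has all its components in the `B_i`, then
`Σ_i dim C_i + dim ⨆_i B_i = Σ_i dim B_i + dim ⨆_i C_i`. [folklore] -/
theorem sum_finrank_add_finrank_iSup_eq_of_forall_rel (B C : ι → Submodule ℚ M) [∀ i, Module.Finite ℚ (C i)]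
    (hBC : ∀ i, B i ≤ C i)
    (hrel : ∀ w : ι → M, (∀ i, w i ∈ C i) → ∑ i, w i = 0 → ∀ i, w i ∈ B i) :
    (∑ i, Module.finrank ℚ (C i)) + Module.finrank ℚ (⨆ i, B i : Submodule ℚ M) =
      (∑ i, Module.finrank ℚ (B i)) + Module.finrank ℚ (⨆ i, C i : Submodule ℚ M) := by
  haveI : ∀ i, Module.Finite ℚ (B i) := fun i =>
    Module.Finite.of_injective (Submodule.inclusion (hBC i)) (Submodule.inclusion_injective (hBC i))
  -- component-wise inclusion
  let Ψ : (∀ i, ↥(B i)) →ₗ[ℚ] (∀ i, ↥(C i)) :=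
    LinearMap.pi fun i => Submodule.inclusion (hBC i) ∘ₗ LinearMap.proj i
  have hΨ : ∀ (v : ∀ i, ↥(B i)) (i : ι), (Ψ v i : M) = (v i : M) := fun v i => rfl
  have hΨinj : Function.Injective Ψ := by
    intro v v' hvv'
    funext i
    apply Subtype.ext
    rw [← hΨ v i, ← hΨ v' i, hvv']
  -- the kernels correspond under `Ψ`
  have hker : (LinearMap.ker (∑ i, (B i).subtype ∘ₗ LinearMap.proj (R := ℚ) (φ := fun i => ↥(B i)) i)).map Ψ =
      LinearMap.ker (∑ i, (C i).subtype ∘ₗ LinearMap.proj (R := ℚ) (φ := fun i => ↥(C i)) i) := by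
    apply le_antisymm
    · rintro _ ⟨v, hv, rfl⟩
      simp only [SetLike.mem_coe, LinearMap.mem_ker, LinearMap.sum_apply] at hv ⊢
      rw [← hv]
      exact Finset.sum_congr rfl fun i _ => hΨ v i
    · intro w hw
      rw [LinearMap.mem_ker, LinearMap.sum_apply] at hw
      have hw' : ∑ i, (w i : M) = 0 := hw
      have hmem := hrel (fun i => (w i : M)) (fun i => (w i).2) hw'
      refine ⟨fun i => ⟨(w i : M), hmem i⟩, ?_, ?_⟩
      · rw [SetLike.mem_coe, LinearMap.mem_ker, LinearMap.sum_apply]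
        exact hw'
      · funext i
        exact Subtype.ext rfl
  have hkfin : Module.finrank ℚ (LinearMap.ker (∑ i, (B i).subtype ∘ₗ LinearMap.proj (R := ℚ)
      (φ := fun i => ↥(B i)) i)) = Module.finrank ℚ (LinearMap.ker (∑ i, (C i).subtype ∘ₗ
        LinearMap.proj (R := ℚ) (φ := fun i => ↥(C i)) i)) := by
    rw [← hker]
    exact LinearEquiv.finrank_eq (Submodule.equivMapOfInjective Ψ hΨinj _)
  rw [sum_finrank_eq_finrank_iSup_add_finrank_ker B, sum_finrank_eq_finrank_iSup_add_finrank_ker C, hkfin]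
  ring

end Bookkeeping

/-! ### §2 Relations among matrix coefficients have their components in the fibre-sum spaces -/

section Relations

variable {G : Type w} [Group G] {I : Type u} {E : I → Type v} [∀ i, MulAction G (E i)] [Fintype I] [DecidableEq I]
  [∀ i, Fintype (E i)] {Y : Type v'} [DecidableEq Y]

/-- **Every component of a relation among matrix coefficients lies in its fibre-sum space.**  If `Σ_i c_i = 0` with
`c_i ∈ MC_i`, then `c_j = −Σ_{i≠j} c_i` is right-invariant under the pointwise stabiliser `N_j` of `E_j` and under
`⋂_{i≠j} N_i`; so for `N ≤ ⟨N_j ∪ ⋂_{i≠j} N_i⟩` transitive on the fibres of `r_j`, `c_j ∈ F_j` (averaging lemma).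
[cite: Serre1977, §3.3] [cite: Gordon1999HodgeAVSurvey, §3 Theorem (proof)] -/
theorem mem_span_fibreSum_of_rel (Φ : ∀ i, Set (E i)) (r : ∀ i, E i → Y) (N : Subgroup G) (j : I)
    (hN : ∀ x x' : E j, r j x = r j x' → ∃ n ∈ N, n • x = x')
    (hNcl : (N : Set G) ⊆ Subgroup.closure
      ({g : G | ∀ x : E j, g • x = x} ∪ {g : G | ∀ i, i ≠ j → ∀ x : E i, g • x = x}))
    (c : I → G → ℚ) (hc : ∀ i, c i ∈ Submodule.span ℚ (Set.range fun x : E i => fun g : G => antiVec (Φ i) g x))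
    (hsum : ∑ i, c i = 0) :
    c j ∈ Submodule.span ℚ (Set.range fun y : Y => fun g : G =>
      ∑ x ∈ Finset.univ.filter (fun x => r j x = y), antiVec (Φ j) g x) := by
  -- `c_j = −Σ_{i≠j} c_i`
  have hcj : c j = -∑ i ∈ Finset.univ.erase j, c i := by
    rw [eq_neg_iff_add_eq_zero, Finset.add_sum_erase _ _ (Finset.mem_univ j)]
    exact hsum
  have hS : ∀ n ∈ ({g : G | ∀ x : E j, g • x = x} ∪ {g : G | ∀ i, i ≠ j → ∀ x : E i, g • x = x}), ∀ g : G,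
      c j (g * n) = c j g := by
    rintro n (hn | hn) g
    · exact apply_mul_eq_of_mem_span_coeff (Φ j) (hc j) hn g
    · rw [hcj]
      simp only [Pi.neg_apply, Finset.sum_apply, neg_inj]
      exact Finset.sum_congr rfl fun i hi =>
        apply_mul_eq_of_mem_span_coeff (Φ i) (hc i) (hn i (Finset.ne_of_mem_erase hi)) g
  exact mem_span_fibreSum_of_forall_apply_mul_eq (Φ j) (r j) N hN (hc j)
    fun n hn g => forall_apply_mul_eq_of_mem_closure hS (hNcl hn) g

/-- **THE FAMILY TRANSFER: `(MC_i)` and `(F_i)` have the same defect** — `Σ_i dim MC_i + dim ⨆_i F_i =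
Σ_i dim F_i + dim ⨆_i MC_i` — when, for every slot `j`, a subgroup `N` transitive on the fibres of `r_j` lies in
`⟨N_j ∪ ⋂_{i≠j} N_i⟩`. [cite: Gordon1999HodgeAVSurvey, §3 Theorem (proof)] [cite: Serre1977, §3.3] -/
theorem sum_finrank_coeff_add_finrank_iSup_fibreSum_eq (Φ : ∀ i, Set (E i)) (r : ∀ i, E i → Y) (N : Subgroup G)
    (hN : ∀ (j : I) (x x' : E j), r j x = r j x' → ∃ n ∈ N, n • x = x')
    (hNcl : ∀ j : I, (N : Set G) ⊆ Subgroup.closure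
      ({g : G | ∀ x : E j, g • x = x} ∪ {g : G | ∀ i, i ≠ j → ∀ x : E i, g • x = x})) :
    (∑ i, Module.finrank ℚ (Submodule.span ℚ (Set.range fun x : E i => fun g : G => antiVec (Φ i) g x))) +
        Module.finrank ℚ (⨆ i, Submodule.span ℚ (Set.range fun y : Y => fun g : G =>
          ∑ x ∈ Finset.univ.filter (fun x => r i x = y), antiVec (Φ i) g x) : Submodule ℚ (G → ℚ)) =
      (∑ i, Module.finrank ℚ (Submodule.span ℚ (Set.range fun y : Y => fun g : G =>
          ∑ x ∈ Finset.univ.filter (fun x => r i x = y), antiVec (Φ i) g x))) +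
        Module.finrank ℚ (⨆ i, Submodule.span ℚ (Set.range fun x : E i => fun g : G => antiVec (Φ i) g x) :
          Submodule ℚ (G → ℚ)) := by
  haveI := fun i => finite_span_coeff (G := G) (Φ i)
  exact sum_finrank_add_finrank_iSup_eq_of_forall_rel _ _ (fun i => span_fibreSum_le_span_coeff (G := G) (Φ i) (r i))
    fun c hc hsum j => mem_span_fibreSum_of_rel Φ r N j (hN j) (hNcl j) c hc hsum

variable [∀ i, Nonempty (E i)] [Nonempty I]

/-- **THE EXACT FAMILY DEFECT ON THE PIVOT**: `Σ_i rank Φ_i + 1 + dim ⨆_i F_i = rank(Σ) + |I| + Σ_i dim F_i`, i.e.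
**`Σ_i dim Hg(A_i) − dim Hg(∏_i A_i) = Σ_i dim F_i − dim Σ_i F_i`** (same hypotheses).
[cite: Deligne1982HodgeCycles, I.5 (p. 53)] [cite: Gordon1999HodgeAVSurvey, §3 Theorem and 7.7] -/
theorem sum_typeRank_add_one_add_finrank_iSup_fibreSum_eq {ρ : G} {Φ : ∀ i, Set (E i)} (h : ∀ i, IsCMTypeWith ρ (Φ i))
    (r : ∀ i, E i → Y) (N : Subgroup G) (hN : ∀ (j : I) (x x' : E j), r j x = r j x' → ∃ n ∈ N, n • x = x')
    (hNcl : ∀ j : I, (N : Set G) ⊆ Subgroup.closure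
      ({g : G | ∀ x : E j, g • x = x} ∪ {g : G | ∀ i, i ≠ j → ∀ x : E i, g • x = x})) :
    (∑ i, typeRank G (Φ i)) + 1 + Module.finrank ℚ (⨆ i, Submodule.span ℚ (Set.range fun y : Y => fun g : G =>
          ∑ x ∈ Finset.univ.filter (fun x => r i x = y), antiVec (Φ i) g x) : Submodule ℚ (G → ℚ)) =
      typeRank G (sigmaType Φ) + Fintype.card I +
        ∑ i, Module.finrank ℚ (Submodule.span ℚ (Set.range fun y : Y => fun g : G =>
          ∑ x ∈ Finset.univ.filter (fun x => r i x = y), antiVec (Φ i) g x)) := by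
  have h1 := typeRank_sigmaType_add_card_add_sum_finrank_eq h
  have h2 := sum_finrank_coeff_add_finrank_iSup_fibreSum_eq Φ r N hN hNcl
  omega

end Relations

/-! ### §3 The Hecke reading for families on a torsor -/

section Hecke

variable {G : Type w} [Group G] {I : Type u} {E : I → Type v} [∀ i, MulAction G (E i)] [Fintype I] [DecidableEq I]
  [∀ i, Fintype (E i)] {Y : Type v'} [MulAction G Y] [DecidableEq Y] {Γ : Type*}

omit [Fintype I] [DecidableEq I] in
/-- Transport of `Σ_i dim` and `dim ⨆_i` from the Hecke modules `span{w_i ∘ q_σ}` on the torsor to the fibre-sum spaces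
(pull-back along `g ↦ g·y₀`). [cite: Shimura1998, §8.1 and §8.3] -/
theorem finrank_iSup_span_precomp_eq (Φ : ∀ i, Set (E i)) (r : ∀ i, E i → Y)
    (hr : ∀ (i : I) (g : G) (x : E i), r i (g • x) = g • r i x)
    (q : Γ → Y → Y) (hq : ∀ (σ : Γ) (g : G) (y : Y), q σ (g • y) = g • q σ y) (y₀ : Y)
    (hcov : ∀ y, ∃ σ, q σ y₀ = y) (htrans : ∀ y : Y, ∃ g : G, g • y₀ = y) :
    Module.finrank ℚ (⨆ i, Submodule.span ℚ (Set.range fun σ : Γ => fun y : Y =>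
        ∑ x ∈ Finset.univ.filter (fun x => r i x = q σ y), antiVec (Φ i) (1 : G) x) : Submodule ℚ (Y → ℚ)) =
      Module.finrank ℚ (⨆ i, Submodule.span ℚ (Set.range fun y : Y => fun g : G =>
        ∑ x ∈ Finset.univ.filter (fun x => r i x = y), antiVec (Φ i) g x) : Submodule ℚ (G → ℚ)) ∧
    ∀ i, Module.finrank ℚ (Submodule.span ℚ (Set.range fun σ : Γ => fun y : Y =>
        ∑ x ∈ Finset.univ.filter (fun x => r i x = q σ y), antiVec (Φ i) (1 : G) x)) =
      Module.finrank ℚ (Submodule.span ℚ (Set.range fun y : Y => fun g : G =>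
        ∑ x ∈ Finset.univ.filter (fun x => r i x = y), antiVec (Φ i) g x)) := by
  have hinj := funLeft_orbitMap_injective (G := G) y₀ htrans
  refine ⟨?_, fun i => ?_⟩
  · rw [← iSup_congr fun i => map_span_precomp_eq_span_fibreSum (Φ i) (r i) (hr i) q hq y₀ hcov,
      ← Submodule.map_iSup]
    exact LinearEquiv.finrank_eq (Submodule.equivMapOfInjective _ hinj _)
  · rw [← map_span_precomp_eq_span_fibreSum (Φ i) (r i) (hr i) q hq y₀ hcov]
    exact LinearEquiv.finrank_eq (Submodule.equivMapOfInjective _ hinj _)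

variable [∀ i, Nonempty (E i)] [Nonempty I]

/-- **THE EXACT FAMILY DEFECT IN HECKE FORM.**  Family of CM types with equivariant pivot maps `r_i : E_i → Y` onto a
torsor (`G` transitive on `Y`, `q_σ` commuting with `G`, `{q_σ y₀} = Y`), `N ≤ G` transitive on all fibres with
`N ≤ ⟨N_j ∪ ⋂_{i≠j} N_i⟩` for every slot `j`.  Then `Σ_i rank Φ_i + 1 + dim(Σ_i w_iℚ[Γ]) = rank(Σ) + |I| + Σ_i dim(w_iℚ[Γ])`,
i.e. **`Σ_i dim Hg(A_i) − dim Hg(∏_i A_i) = Σ_i dim(w_iℚ[Γ]) − dim(Σ_i w_iℚ[Γ])`** — the defect of the family is the defect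
of the right ideals generated by the shadows `w_i = (r_i)_* u_i` in the group ring of the torsor.
[cite: Kubota1965, §2 and §4] [cite: Gordon1999HodgeAVSurvey, §3 Theorem and 7.5–7.7] [cite: Deligne1982HodgeCycles, I.5 (p. 53)] -/
theorem sum_typeRank_add_one_add_finrank_iSup_span_precomp_eq {ρ : G} {Φ : ∀ i, Set (E i)}
    (h : ∀ i, IsCMTypeWith ρ (Φ i)) (r : ∀ i, E i → Y) (hr : ∀ (i : I) (g : G) (x : E i), r i (g • x) = g • r i x)
    (N : Subgroup G) (hN : ∀ (j : I) (x x' : E j), r j x = r j x' → ∃ n ∈ N, n • x = x')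
    (hNcl : ∀ j : I, (N : Set G) ⊆ Subgroup.closure
      ({g : G | ∀ x : E j, g • x = x} ∪ {g : G | ∀ i, i ≠ j → ∀ x : E i, g • x = x}))
    (q : Γ → Y → Y) (hq : ∀ (σ : Γ) (g : G) (y : Y), q σ (g • y) = g • q σ y) (y₀ : Y)
    (hcov : ∀ y, ∃ σ, q σ y₀ = y) (htrans : ∀ y : Y, ∃ g : G, g • y₀ = y) :
    (∑ i, typeRank G (Φ i)) + 1 + Module.finrank ℚ (⨆ i, Submodule.span ℚ (Set.range fun σ : Γ => fun y : Y =>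
          ∑ x ∈ Finset.univ.filter (fun x => r i x = q σ y), antiVec (Φ i) (1 : G) x) : Submodule ℚ (Y → ℚ)) =
      typeRank G (sigmaType Φ) + Fintype.card I +
        ∑ i, Module.finrank ℚ (Submodule.span ℚ (Set.range fun σ : Γ => fun y : Y =>
          ∑ x ∈ Finset.univ.filter (fun x => r i x = q σ y), antiVec (Φ i) (1 : G) x)) := by
  obtain ⟨hsup, hmem⟩ := finrank_iSup_span_precomp_eq Φ r hr q hq y₀ hcov htrans
  rw [hsup, Finset.sum_congr rfl fun i _ => hmem i]
  exact sum_typeRank_add_one_add_finrank_iSup_fibreSum_eq h r N hN hNcl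

/-- **The family is additive (`Hg(∏_i A_i) = ∏_i Hg(A_i)`) iff the right ideals `w_iℚ[Γ]` of the shadows are
INDEPENDENT** (same hypotheses). [cite: Kubota1965, §2 and §4] [cite: Gordon1999HodgeAVSurvey, §3 Theorem and 7.5–7.7] -/
theorem typeRank_sigmaType_add_card_eq_iff_iSupIndep_span_precomp {ρ : G} {Φ : ∀ i, Set (E i)}
    (h : ∀ i, IsCMTypeWith ρ (Φ i)) (r : ∀ i, E i → Y) (hr : ∀ (i : I) (g : G) (x : E i), r i (g • x) = g • r i x)
    (N : Subgroup G) (hN : ∀ (j : I) (x x' : E j), r j x = r j x' → ∃ n ∈ N, n • x = x')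
    (hNcl : ∀ j : I, (N : Set G) ⊆ Subgroup.closure
      ({g : G | ∀ x : E j, g • x = x} ∪ {g : G | ∀ i, i ≠ j → ∀ x : E i, g • x = x}))
    (q : Γ → Y → Y) (hq : ∀ (σ : Γ) (g : G) (y : Y), q σ (g • y) = g • q σ y) (y₀ : Y)
    (hcov : ∀ y, ∃ σ, q σ y₀ = y) (htrans : ∀ y : Y, ∃ g : G, g • y₀ = y) [Fintype Y] :
    typeRank G (sigmaType Φ) + Fintype.card I = (∑ i, typeRank G (Φ i)) + 1 ↔
      iSupIndep fun i => Submodule.span ℚ (Set.range fun σ : Γ => fun y : Y =>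
        ∑ x ∈ Finset.univ.filter (fun x => r i x = q σ y), antiVec (Φ i) (1 : G) x) := by
  rw [← finrank_iSup_eq_sum_finrank_iff_iSupIndep]
  have := sum_typeRank_add_one_add_finrank_iSup_span_precomp_eq h r hr N hN hNcl q hq y₀ hcov htrans
  omega

end Hecke

end Summit.HodgeConjecture.CorCM.IrrOdd

end
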